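import Summits.ResolutionOfSingularities.ResolutionOfSingularities.Theorems.ValuativeLuAlphaPTorsorPthPowerModMonomialHelpers

/-!
# Terminal forms of the log content (crux `Valuative.LuAlphaPTorsor`, line `pfaff-line-log-final-forms`)

Helper file for stub `stub_logPrincipalization` (sub-goals H2 and H2b) of the lead's skeleton
for item `stmt-ResolutionOfSingularities-0641`.

Setting: `R` a commutative ring with a `ℤ`-algebra structure and `p = 0` in `R`,
`u : Fin d → R` ("regular parameters"), a boundary `E ⊆ Fin d`. The *log content* of `a ∈ R`
along `E` is the ideal
`C_E(a) := Ideal.span {b | ∃ δ : Derivation ℤ R R, (∀ i ∈ E, δ (u i) ∈ (u i)) ∧ δ a = b}`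
generated by the values at `a` of all `ℤ`-derivations logarithmic along the boundary.

* `content_eq_span_prod_pow_of_eq_pow_add_unit_mul` (H2, terminal-form recognition): if `R` is
  local, the `u i` lie in `𝔪`, `D i` are derivations dual to the `u j` (`D i (u j) = [i = j]`),
  and `a = c ^ p + v * ∏_{i ∈ E} u_i ^ M_i` with `v` a unit and some `M_i` (`i ∈ E`) prime to
  `p`, then `C_E(a) = (∏_{i ∈ E} u_i ^ M_i)` exactly.
  Proof: `⊆` since derivations kill `p`-th powers and the log derivative of a monomial is a
  multiple of the monomial; `⊇` using the log derivation `u_{i₀} • D_{i₀}` (`p ∤ M_{i₀}`), whose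
  value at `a` is `(∏ u^M) · (M_{i₀} v + u_{i₀} D_{i₀} v)`, a unit multiple of the monomial
  (`M_{i₀}` is invertible in the `𝔽_p`-algebra `R`, `u_{i₀} D_{i₀} v ∈ 𝔪`).
* `content_pow_mul_eq_span_pow_mul_content` (H2b): `C_E(g ^ p * b) = (g ^ p) * C_E(b)`, because
  `δ (g ^ p * b) = g ^ p * δ b` for every derivation `δ`.

The elementary facts `isUnit_natCast_of_not_dvd`, `derivation_apply_pow_eq_zero`,
`derivation_prod_pow_eq_sum_mul_prod` and `smul_dual_log` are reused from
`Theorems/ValuativeLuAlphaPTorsorPthPowerModMonomialHelpers.lean`. [folklore]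
-/

-- single-problem summit: the doubled namespace component `ResolutionOfSingularities` is forced
set_option linter.dupNamespace false

namespace Summit.ResolutionOfSingularities.ResolutionOfSingularities.Theorems.PfaffLine

open IsLocalRing

/-- With `p = 0` in `R`, a `p`-th power factor passes through every derivation:
`δ (g ^ p * b) = g ^ p * δ b`. [folklore] -/
theorem derivation_apply_pow_mul_of_natCast_eq_zero {R : Type*} [CommRing R] [Algebra ℤ R]
    {p : ℕ} (hpR : (p : R) = 0) (δ : Derivation ℤ R R) (g b : R) :
    δ (g ^ p * b) = g ^ p * δ b := by
  rw [Derivation.leibniz, derivation_apply_pow_eq_zero hpR, smul_zero, add_zero, smul_eq_mul]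

/-- **Log derivative of a monomial stays in the monomial ideal.** If `δ (u i) ∈ (u i)` for all
`i ∈ E`, then `δ (∏_{i ∈ E} u_i ^ M_i) ∈ (∏_{i ∈ E} u_i ^ M_i)`. [folklore] -/
theorem derivation_prod_pow_mem_span_prod_pow {R : Type*} [CommRing R] [Algebra ℤ R]
    (δ : Derivation ℤ R R) {ι : Type*} [DecidableEq ι] (E : Finset ι) (u : ι → R) (M : ι → ℕ)
    (hδ : ∀ i ∈ E, δ (u i) ∈ Ideal.span {u i}) :
    δ (E.prod fun i => u i ^ M i) ∈ Ideal.span {E.prod fun i => u i ^ M i} := by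
  have hex : ∀ i, ∃ e : R, i ∈ E → δ (u i) = e * u i := by
    intro i
    by_cases hi : i ∈ E
    · obtain ⟨e, he⟩ := Ideal.mem_span_singleton'.mp (hδ i hi)
      exact ⟨e, fun _ => he.symm⟩
    · exact ⟨0, fun h => absurd h hi⟩
  choose e he using hex
  rw [derivation_prod_pow_eq_sum_mul_prod δ E u M e he]
  exact Ideal.mul_mem_left _ _ (Ideal.mem_span_singleton_self _)

/-- **Upper bound for the log content of a final form.** For `a = c ^ p + v * ∏_{i ∈ E} u_i^{M_i}`
(any `v`), every `E`-logarithmic derivation maps `a` into `(∏_{i ∈ E} u_i ^ M_i)`. [folklore] -/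
theorem content_le_span_prod_pow_of_eq_pow_add_mul {R : Type*} [CommRing R] [Algebra ℤ R]
    {p : ℕ} (hpR : (p : R) = 0) {ι : Type*} [DecidableEq ι] (u : ι → R) (E : Finset ι)
    (M : ι → ℕ) (a c v : R) (ha : a = c ^ p + v * E.prod (fun i => u i ^ M i)) :
    Ideal.span {b | ∃ δ : Derivation ℤ R R, (∀ i ∈ E, δ (u i) ∈ Ideal.span {u i}) ∧ δ a = b} ≤
      Ideal.span {E.prod fun i => u i ^ M i} := by
  rw [Ideal.span_le]
  rintro b ⟨δ, hδ, rfl⟩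
  rw [SetLike.mem_coe, ha, map_add, derivation_apply_pow_eq_zero hpR, zero_add,
    Derivation.leibniz, smul_eq_mul, smul_eq_mul]
  exact Ideal.add_mem _ (Ideal.mul_mem_left _ _ (derivation_prod_pow_mem_span_prod_pow δ E u M hδ))
    (Ideal.mul_mem_right _ _ (Ideal.mem_span_singleton_self _))

/-- In a local ring, a unit plus an element of the maximal ideal is a unit. [folklore] -/
private theorem isUnit_add_of_isUnit_of_mem_maximalIdeal {R : Type*} [CommRing R] [IsLocalRing R]
    {x y : R} (hx : IsUnit x) (hy : y ∈ maximalIdeal R) : IsUnit (x + y) := by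
  by_contra hxy
  have hmem : x + y ∈ maximalIdeal R := (mem_maximalIdeal _).2 hxy
  rw [Ideal.add_mem_iff_left _ hy] at hmem
  exact (mem_maximalIdeal _).1 hmem hx

/-- **H2 — terminal-form recognition.** In a local ring `R` with `p = 0` (`p` prime), let
`u : Fin d → R` lie in `𝔪`, `D i` be derivations dual to the `u j`, and
`a = c ^ p + v * ∏_{i ∈ E} u_i ^ M_i` with `v` a unit and `p ∤ M_i` for some `i ∈ E`. Then the
log content of `a` along `E` is exactly `(∏_{i ∈ E} u_i ^ M_i)`. [folklore] -/
theorem content_eq_span_prod_pow_of_eq_pow_add_unit_mul : ∀ {R : Type*} [CommRing R] [Algebra ℤ R] [IsLocalRing R] {p : ℕ}, p.Prime → (p : R) = 0 → ∀ {d : ℕ} (u : Fin d → R), (∀ i, u i ∈ maximalIdeal R) → ∀ (E : Finset (Fin d)) (M : Fin d → ℕ) (D : Fin d → Derivation ℤ R R), (∀ i j, D i (u j) = if i = j then 1 else 0) → ∀ (a c v : R), IsUnit v → a = c ^ p + v * E.prod (fun i => u i ^ M i) → (∃ i ∈ E, ¬ p ∣ M i) → Ideal.span {b | ∃ δ : Derivation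 ℤ R R, (∀ i ∈ E, δ (u i) ∈ Ideal.span {u i}) ∧ δ a = b} = Ideal.span {E.prod fun i => u i ^ M i} := by
  intro R _ _ _ p hp hpR d u hu E M D hD a c v hv ha hne
  obtain ⟨i₀, hi₀E, hi₀⟩ := hne
  refine le_antisymm (content_le_span_prod_pow_of_eq_pow_add_mul hpR u E M a c v ha) ?_
  rw [Ideal.span_singleton_le_iff_mem]
  set m : R := E.prod fun i => u i ^ M i with hm_def
  -- the log derivation `δ := u i₀ • D i₀`
  set δ : Derivation ℤ R R := u i₀ • D i₀ with hδ_def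
  have hδu : ∀ i, δ (u i) = (if i₀ = i then 1 else 0) * u i := by
    intro i
    rw [hδ_def, Derivation.smul_apply, hD, smul_eq_mul]
    split_ifs with h
    · subst h; ring
    · ring
  have hδlog : ∀ i ∈ E, δ (u i) ∈ Ideal.span {u i} := fun i _ => smul_dual_log u D hD i₀ i
  -- `δ m = M i₀ * m`
  have hδm : δ m = (M i₀ : R) * m := by
    rw [hm_def, derivation_prod_pow_eq_sum_mul_prod δ E u M _ (fun i _ => hδu i)]
    congr 1
    rw [Finset.sum_eq_single i₀ (fun j _ hj => by rw [if_neg (Ne.symm hj), mul_zero])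
      (fun h => absurd hi₀E h), if_pos rfl, mul_one]
  -- `δ a = m * w` with `w = M i₀ * v + u i₀ * D i₀ v`
  have hδa : δ a = m * ((M i₀ : R) * v + u i₀ * D i₀ v) := by
    rw [ha, map_add, derivation_apply_pow_eq_zero hpR, zero_add, Derivation.leibniz,
      smul_eq_mul, smul_eq_mul, hδm, hδ_def, Derivation.smul_apply, smul_eq_mul]
    ring
  -- `w` is a unit: `M i₀` is invertible, `v` is a unit, `u i₀ * D i₀ v ∈ 𝔪`
  have hw : IsUnit ((M i₀ : R) * v + u i₀ * D i₀ v) :=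
    isUnit_add_of_isUnit_of_mem_maximalIdeal ((isUnit_natCast_of_not_dvd hp hpR hi₀).mul hv)
      (Ideal.mul_mem_right _ _ (hu i₀))
  obtain ⟨w, hw'⟩ := hw
  have hm : m = δ a * ↑w⁻¹ := by
    rw [hδa, ← hw', mul_assoc, Units.mul_inv, mul_one]
  rw [hm]
  exact Ideal.mul_mem_right _ _ (Ideal.subset_span ⟨δ, hδlog, rfl⟩)

/-- **H2b — `p`-th powers pull out of the log content.** With `p = 0` in `R`,
`C_E(g ^ p * b) = (g ^ p) * C_E(b)`: a `p`-th power factor is invisible to derivations.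
[folklore] -/
theorem content_pow_mul_eq_span_pow_mul_content : ∀ {R : Type*} [CommRing R] [Algebra ℤ R] {p : ℕ}, (p : R) = 0 → ∀ {d : ℕ} (u : Fin d → R) (E : Finset (Fin d)) (g b : R), Ideal.span {x | ∃ δ : Derivation ℤ R R, (∀ i ∈ E, δ (u i) ∈ Ideal.span {u i}) ∧ δ (g ^ p * b) = x} = Ideal.span {g ^ p} * Ideal.span {x | ∃ δ : Derivation ℤ R R, (∀ i ∈ E, δ (u i) ∈ Ideal.span {u i}) ∧ δ b = x} := by
  intro R _ _ p hpR d u E g b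
  rw [Ideal.span_mul_span', Set.singleton_mul]
  congr 1
  ext x
  simp only [Set.mem_setOf_eq, Set.mem_image, derivation_apply_pow_mul_of_natCast_eq_zero hpR]
  constructor
  · rintro ⟨δ, hδ, rfl⟩
    exact ⟨δ b, ⟨δ, hδ, rfl⟩, rfl⟩
  · rintro ⟨_, ⟨δ, hδ, rfl⟩, rfl⟩
    exact ⟨δ, hδ, rfl⟩

end Summit.ResolutionOfSingularities.ResolutionOfSingularities.Theorems.PfaffLine
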